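import Summits.BirchSwinnertonDyer.BirchSwinnertonDyer.Theorems.ByReductionTypeAtTwoAdditivePotGoodLowerHalfT0NarrowRankLayerTwoResidueMap
import Summits.BirchSwinnertonDyer.BirchSwinnertonDyer.Theorems.ByReductionTypeAtTwoAdditivePotGoodLowerHalfT0NarrowRankLayerTwoTotPosSignsARow467928d1
import Summits.BirchSwinnertonDyer.BirchSwinnertonDyer.Theorems.ByReductionTypeAtTwoAdditivePotGoodLowerHalfT0NarrowRankLayerTwoTotPosSignsBRow467928d1
import Summits.BirchSwinnertonDyer.BirchSwinnertonDyer.Theorems.ByReductionTypeAtTwoAdditivePotGoodLowerHalfT0NarrowRankLayerTwoTotPosUnitsRow467928d1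
import HarnessLib

/-!
# K4 crux `AdditiveRankZeroAtTwo` (19098), children C3″ `AdditivePotGoodLowerHalfAtTwo` (22617) / C1″ (22615): census row `467928d1` — the displayed
# hypothesis (hlow) `2^3 ≤ #(U⁺/U²)(A₂)` of the rung-`m = 2` stamp DISCHARGED IN THE KERNEL (`A₂ = ℚ(θ) ⊔ ℚ_2`, degree `12`,
# `θ³ + (-1)θ² + (-102)θ + (-342) = 0`): three totally positive units, independent modulo unit squares
# (seat `bsd-2adic-k4-w2` GEN 16, key «HLOW-12»; `--supports stmt-BirchSwinnertonDyer-22617 --as helper`)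

Cell `bsd-2adic`.  THEOREMS ONLY (no definition, no named fact, no `sorry`).  KERNEL chain: the generator units of `A₂` in TOWER COORDINATES
`b = θ`, `s = √2 = e² − 2`, `e = √(2+√2) ∈ ℚ_2` with exact inverse certificates (`…TotPosSignsBRow467928d1`; data GEN 15
`k4w2/gen15/DATA-HLOW12-k4w2-GEN15.md`, eng-2 CERT-NARROW6-E2 v1.3 §6.1 (W) classes: `u1` = class of mask 1 (orig); `u2` = class of mask 3 (balanced2); `u3` = class of mask 6 (balanced2)); POSITIVITY at the twelve real places —
every `σ : A₂ → ℝ` restricts to one of the three located embeddings of `ℚ(θ)` (`card_realEmbeddings`) and maps `(s, e)` to `(±√2, ±√(2±√2))`, and on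
each of the `12` sign patterns the generators are positive (`…TotPosSigns{A,B}Row467928d1`); NON-SQUARES — each of the `2^3 − 1` products reduces, under a residue map `𝓞_{A₂} → 𝔽_{17}` through
the order `ℤ[θ, e]` (GEN 16 `exists_ringHom_ringOfIntegers_sup_layer_two_zmod`, `17 ∤ 16·disc`), to a quadratic non-residue (`decide`), so it is not a
unit square (`not_exists_eq_sq_of_map_not_isSquare`); the counting door `eight_le_card_totPosUnitsModSq_of_ne_sq` (GEN 15) gives
★ `eight_le_card_totPosUnitsModSq_sup_layer_two_d51992p` = (hlow).  The re-stamp with (hsig) ALONE displayed is the sequel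
`…NarrowRankSignBoundRow467928d1`.

HONEST FRAMING (D-0036 / D-0054 / D-0152): kernel arithmetic about one number field; closes nothing at the `∀`-level (C3″ 22617 / C1″ 22615
research-open); nothing booked; census tier of the row unchanged (CERT; displayed data `2 → 1` after the sequel); BSD is not proved by any of this.

References: [FrohlichTaylor1990] Ch. V §1 (1.10)–(1.13), pp. 163–164; [Cohen1993] §4.1.3, §6.3; [Washington1997] §13.1; [Marcus1977] Ch. 2 Ex. 41,
Ch. 3 Thm. 27; [EdgarMollinPeterson1986] Thm. 2.1.
-/

set_option autoImplicit false
-- the Theorems namespace of this sub repeats the summit name by design (D-0017 nested layout)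
set_option linter.dupNamespace false

noncomputable section

open scoped Classical IntermediateField NumberField Polynomial

namespace Summit.BirchSwinnertonDyer.BirchSwinnertonDyer.Theorems.AddKatoTwo

open Polynomial IsDedekindDomain NumberField Field IntermediateField
  Literature.NumberTheory.EllipticCurves Literature.NumberTheory.EllipticCurves.ZpExtension
  Literature.NumberTheory.IwasawaTheory Literature.NumberTheory.NumberFields
  Literature.NumberTheory.GaloisRepresentations Literature.Geometry.Kaehler.ComplexTorus

variable {θ : AlgebraicClosure ℚ}


/-- Instance-free residue map (the primality of `ℓ` as a hypothesis; cf. `exists_ringHom_ringOfIntegers_sup_layer_two_zmod'`).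
[cite: Marcus1977, Ch. 3 Thm. 27] -/
private theorem exists_ringHom_zmod_aux_d51992p {p q r : ℤ} (hirr : Irreducible (Cubic.toPoly ⟨1, (p : ℚ), q, r⟩))
    (hθ : aeval θ (Cubic.toPoly ⟨1, (p : ℚ), q, r⟩) = 0)
    (hreal : haveI : FiniteDimensional ℚ ↥ℚ⟮θ⟯ :=
        IntermediateField.adjoin.finiteDimensional ⟨_, Cubic.monic_of_a_eq_one', by rwa [← aeval_def]⟩
      haveI : NumberField ↥ℚ⟮θ⟯ := NumberField.mk
      IsTotallyReal ↥ℚ⟮θ⟯)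
    {e : AlgebraicClosure ℚ} (he : e ∈ (CyclotomicZp.zpExtension 2).layer 2) (he0 : (fun x : AlgebraicClosure ℚ => x ^ 2 - 2)^[2] e = 0)
    {ℓ : ℕ} (hℓp : ℓ.Prime) (hℓ : ((16 * Cubic.discr ⟨1, p, q, r⟩ : ℤ) : ZMod ℓ) ≠ 0)
    {x y : ZMod ℓ} (hx : x ^ 3 + (p : ZMod ℓ) * x ^ 2 + (q : ZMod ℓ) * x + (r : ZMod ℓ) = 0) (hy : y ^ 4 - 4 * y ^ 2 + 2 = 0) :
    ∃ φ : 𝓞 ↥(ℚ⟮θ⟯ ⊔ (CyclotomicZp.zpExtension 2).layer 2) →+* ZMod ℓ,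
      (∀ w : 𝓞 ↥(ℚ⟮θ⟯ ⊔ (CyclotomicZp.zpExtension 2).layer 2), (w : ↥(ℚ⟮θ⟯ ⊔ (CyclotomicZp.zpExtension 2).layer 2)) = inclusion (le_sup_left : ℚ⟮θ⟯ ≤ ℚ⟮θ⟯ ⊔ (CyclotomicZp.zpExtension 2).layer 2) (AdjoinSimple.gen ℚ θ) →
        φ w = x) ∧
      (∀ w : 𝓞 ↥(ℚ⟮θ⟯ ⊔ (CyclotomicZp.zpExtension 2).layer 2), (w : ↥(ℚ⟮θ⟯ ⊔ (CyclotomicZp.zpExtension 2).layer 2)) = (⟨e, (le_sup_right : (CyclotomicZp.zpExtension 2).layer 2 ≤ _) he⟩ : ↥(ℚ⟮θ⟯ ⊔ (CyclotomicZp.zpExtension 2).layer 2)) → φ w = y) := by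
  haveI : Fact ℓ.Prime := ⟨hℓp⟩
  exact exists_ringHom_ringOfIntegers_sup_layer_two_zmod hirr hθ hreal he he0 hℓ hx hy

set_option linter.unusedSimpArgs false in
set_option maxRecDepth 20000 in
set_option maxHeartbeats 12800000 in
set_option synthInstance.maxHeartbeats 400000 in
/-- ★ **(hlow) for `467928d1` IN THE KERNEL: `2^3 ≤ #(U⁺/U²)(A₂)`, `A₂ = ℚ(θ) ⊔ ℚ_2` (degree `12`), `θ³ − θ² − 102θ − 342 = 0` (`d = 51992`,
index-`3` cubic).**  The three units of `layer_two_totpos_units_d51992p` are TOTALLY POSITIVE at the twelve real places (every `σ` restricts to one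
of the three located embeddings of `ℚ(θ)` and maps `(s, e)` to `(±√2, ±√(2±√2))`; `layer_two_totpos_signs_*_d51992p`) and none of their seven products
is a unit square (residue maps `𝓞_{A₂} → 𝔽₁₇` through the order `ℤ[θ, e]`, `exists_ringHom_ringOfIntegers_sup_layer_two_zmod`, `17 ∤ 16·disc`;
the residues of the units pinned by `12·u = P(θ, s, e)` with `P` integral, `12⁻¹ = 10 (mod 17)`); the counting door
`eight_le_card_totPosUnitsModSq_of_ne_sq`.  Discharges the displayed (hlow) of `conjA_two_467928d1_of_layerBounds₂₃''`.
[cite: FrohlichTaylor1990, Ch. V §1 (1.10)–(1.12), pp. 163–164] [cite: Cohen1993, §4.1.3] [cite: Washington1997, §13.1] -/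
theorem eight_le_card_totPosUnitsModSq_sup_layer_two_d51992p (hθ : aeval θ (Cubic.toPoly ⟨1, ((-1 : ℤ) : ℚ), ((-102 : ℤ) : ℚ), ((-342 : ℤ) : ℚ)⟩) = 0) :
    haveI : FiniteDimensional ℚ ↥ℚ⟮θ⟯ :=
      IntermediateField.adjoin.finiteDimensional ⟨_, Cubic.monic_of_a_eq_one', by rwa [← aeval_def]⟩
    haveI : FiniteDimensional ℚ ↥((CyclotomicZp.zpExtension 2).layer 2) := (CyclotomicZp.zpExtension 2).finiteDimensional_layer_holds 2
    haveI : NumberField ↥(ℚ⟮θ⟯ ⊔ (CyclotomicZp.zpExtension 2).layer 2) := NumberField.mk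
    2 ^ 3 ≤ Nat.card (TotPosUnitsModSq ↥(ℚ⟮θ⟯ ⊔ (CyclotomicZp.zpExtension 2).layer 2)) := by
  haveI : FiniteDimensional ℚ ↥ℚ⟮θ⟯ :=
    IntermediateField.adjoin.finiteDimensional ⟨_, Cubic.monic_of_a_eq_one', by rwa [← aeval_def]⟩
  haveI : FiniteDimensional ℚ ↥((CyclotomicZp.zpExtension 2).layer 2) := (CyclotomicZp.zpExtension 2).finiteDimensional_layer_holds 2
  haveI : NumberField ↥ℚ⟮θ⟯ := NumberField.mk
  haveI : NumberField ↥(ℚ⟮θ⟯ ⊔ (CyclotomicZp.zpExtension 2).layer 2) := NumberField.mk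
  haveI : Fact (Nat.Prime 2) := ⟨Nat.prime_two⟩
  obtain ⟨hreal2, hfin2, h3⟩ := layer_two_basics irreducible_cubic_d51992p hθ (isTotallyReal_adjoin_d51992p_lb hθ)
  haveI := hreal2
  haveI : IsTotallyReal ↥ℚ⟮θ⟯ := isTotallyReal_adjoin_d51992p_lb hθ
  obtain ⟨e, he, -, he4⟩ := CyclotomicZp.exists_mem_layer_two_quartic_zpExtension
  have he0 : (fun x : AlgebraicClosure ℚ => x ^ 2 - 2)^[2] e = 0 := by
    simp only [Function.iterate_succ, Function.iterate_zero, Function.comp_apply, id_eq]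
    linear_combination he4
  have hK2 : ℚ⟮θ⟯ ≤ ℚ⟮θ⟯ ⊔ (CyclotomicZp.zpExtension 2).layer 2 := le_sup_left
  have heA : e ∈ ℚ⟮θ⟯ ⊔ (CyclotomicZp.zpExtension 2).layer 2 := (le_sup_right : (CyclotomicZp.zpExtension 2).layer 2 ≤ _) he
  set e'' : ↥(ℚ⟮θ⟯ ⊔ (CyclotomicZp.zpExtension 2).layer 2) := ⟨e, heA⟩ with he''def
  set θ'' : ↥(ℚ⟮θ⟯ ⊔ (CyclotomicZp.zpExtension 2).layer 2) := inclusion hK2 (AdjoinSimple.gen ℚ θ) with hθ''def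
  set s'' : ↥(ℚ⟮θ⟯ ⊔ (CyclotomicZp.zpExtension 2).layer 2) := e'' ^ 2 - 2 with hs''def
  have hθrel : θ'' ^ 3 + (-1 : ↥(ℚ⟮θ⟯ ⊔ (CyclotomicZp.zpExtension 2).layer 2)) * θ'' ^ 2 + (-102 : ↥(ℚ⟮θ⟯ ⊔ (CyclotomicZp.zpExtension 2).layer 2)) * θ'' + (-342 : ↥(ℚ⟮θ⟯ ⊔ (CyclotomicZp.zpExtension 2).layer 2)) = 0 := by
    have h := hθ
    simp only [Cubic.toPoly, map_one, one_mul, aeval_add, aeval_mul, aeval_C, aeval_X_pow, aeval_X, eq_ratCast] at h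
    push_cast at h
    apply (algebraMap ↥(ℚ⟮θ⟯ ⊔ (CyclotomicZp.zpExtension 2).layer 2) (AlgebraicClosure ℚ)).injective
    rw [hθ''def]
    simp only [map_add, map_mul, map_pow, map_neg, map_one, map_ofNat, map_zero, IntermediateField.algebraMap_apply,
      IntermediateField.coe_inclusion, AdjoinSimple.coe_gen]
    linear_combination h
  have he''4 : e'' ^ 4 - 4 * e'' ^ 2 + 2 = 0 := by
    apply (algebraMap ↥(ℚ⟮θ⟯ ⊔ (CyclotomicZp.zpExtension 2).layer 2) (AlgebraicClosure ℚ)).injective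
    have h := he0
    simp only [Function.iterate_succ, Function.iterate_zero, Function.comp_apply, id_eq] at h
    rw [map_add, map_sub, map_mul, map_pow, map_pow, map_ofNat, map_ofNat, map_zero, IntermediateField.algebraMap_apply]
    linear_combination h
  have hsrel : s'' ^ 2 = 2 := by rw [hs''def]; linear_combination he''4
  have herel : e'' ^ 2 = 2 + s'' := by rw [hs''def]; ring
  have hθint : IsIntegral ℤ θ'' := by
    refine ⟨X ^ 3 + C (-1 : ℤ) * X ^ 2 + C (-102 : ℤ) * X + C (-342 : ℤ), by monicity!, ?_⟩
    simp only [eval₂_add, eval₂_mul, eval₂_pow, eval₂_C, eval₂_X]; simp only [eq_intCast]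
    push_cast; linear_combination hθrel
  have heint : IsIntegral ℤ e'' := by
    refine ⟨X ^ 4 - C (4 : ℤ) * X ^ 2 + C (2 : ℤ), by monicity!, ?_⟩
    simp only [eval₂_add, eval₂_sub, eval₂_mul, eval₂_pow, eval₂_C, eval₂_X]; simp only [eq_intCast, Int.cast_ofNat]
    exact_mod_cast he''4
  set bE : 𝓞 ↥(ℚ⟮θ⟯ ⊔ (CyclotomicZp.zpExtension 2).layer 2) := ⟨θ'', hθint⟩ with hbEdef
  set eE : 𝓞 ↥(ℚ⟮θ⟯ ⊔ (CyclotomicZp.zpExtension 2).layer 2) := ⟨e'', heint⟩ with heEdef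
  set sE : 𝓞 ↥(ℚ⟮θ⟯ ⊔ (CyclotomicZp.zpExtension 2).layer 2) := eE ^ 2 - 2 with hsEdef
  have hbEval : ((bE : 𝓞 ↥(ℚ⟮θ⟯ ⊔ (CyclotomicZp.zpExtension 2).layer 2)) : ↥(ℚ⟮θ⟯ ⊔ (CyclotomicZp.zpExtension 2).layer 2)) = θ'' := rfl
  have heEval : ((eE : 𝓞 ↥(ℚ⟮θ⟯ ⊔ (CyclotomicZp.zpExtension 2).layer 2)) : ↥(ℚ⟮θ⟯ ⊔ (CyclotomicZp.zpExtension 2).layer 2)) = e'' := rfl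
  have hbE' : algebraMap (𝓞 ↥(ℚ⟮θ⟯ ⊔ (CyclotomicZp.zpExtension 2).layer 2)) ↥(ℚ⟮θ⟯ ⊔ (CyclotomicZp.zpExtension 2).layer 2) bE = θ'' := rfl
  have heE' : algebraMap (𝓞 ↥(ℚ⟮θ⟯ ⊔ (CyclotomicZp.zpExtension 2).layer 2)) ↥(ℚ⟮θ⟯ ⊔ (CyclotomicZp.zpExtension 2).layer 2) eE = e'' := rfl
  have hsE' : algebraMap (𝓞 ↥(ℚ⟮θ⟯ ⊔ (CyclotomicZp.zpExtension 2).layer 2)) ↥(ℚ⟮θ⟯ ⊔ (CyclotomicZp.zpExtension 2).layer 2) sE = s'' := by rw [hsEdef, map_sub, map_pow, heE', map_ofNat, hs''def]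
  obtain ⟨u1, u2, u3, hval1, hval2, hval3⟩ := layer_two_totpos_units_d51992p hθ he he0
  -- every real place of `A₂`: `σ|ℚ(θ) ∈ {ρ₀, ρ₁, ρ₂}`, `σ(s'') = ±√2`, `σ(e'') = ±√(2 ± √2)`
  obtain ⟨ρ₀, ρ₁, ρ₂, x0, x1, x2, hρ₀, hρ₁, hρ₂, hl0, hu0, hl1, hu1, hl2, hu2⟩ := exists_three_ringHom_adjoin_hp_d51992p hθ
  have hcardK : Fintype.card (↥ℚ⟮θ⟯ →+* ℝ) = 3 := by rw [card_realEmbeddings, h3]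
  have hne : ∀ {φ ψ : ↥ℚ⟮θ⟯ →+* ℝ} {a c : ℝ}, φ (AdjoinSimple.gen ℚ θ) = a → ψ (AdjoinSimple.gen ℚ θ) = c → a ≠ c → φ ≠ ψ := by
    intro φ ψ a c ha hc hac h; rw [h] at ha; exact hac (ha.symm.trans hc)
  have h01 : ρ₀ ≠ ρ₁ := hne hρ₀ hρ₁ (by intro h; linarith)
  have h02 : ρ₀ ≠ ρ₂ := hne hρ₀ hρ₂ (by intro h; linarith)
  have h12 : ρ₁ ≠ ρ₂ := hne hρ₁ hρ₂ (by intro h; linarith)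
  have huniv : (Finset.univ : Finset (↥ℚ⟮θ⟯ →+* ℝ)) = {ρ₀, ρ₁, ρ₂} := by
    symm
    apply Finset.eq_of_subset_of_card_le (Finset.subset_univ _)
    rw [Finset.card_univ, hcardK, Finset.card_insert_of_notMem (by simp [h01, h02]), Finset.card_insert_of_notMem (by simp [h12]),
      Finset.card_singleton]
  have hsigns : ∀ σ : ↥(ℚ⟮θ⟯ ⊔ (CyclotomicZp.zpExtension 2).layer 2) →+* ℝ, 0 < σ ((16 : ↥(ℚ⟮θ⟯ ⊔ (CyclotomicZp.zpExtension 2).layer 2)) + ((23 : ↥(ℚ⟮θ⟯ ⊔ (CyclotomicZp.zpExtension 2).layer 2)) / 2) * s'' + ((7 : ↥(ℚ⟮θ⟯ ⊔ (CyclotomicZp.zpExtension 2).layer 2)) / 6) * θ'' + ((2 : ↥(ℚ⟮θ⟯ ⊔ (CyclotomicZp.zpExtension 2).layer 2)) / 3) * θ'' * s'' + ((-1 : ↥(ℚ⟮θ⟯ ⊔ (CyclotomicZp.zpExtension 2).layer 2)) / 6) * θ'' ^ 2 + ((-1 : ↥(ℚ⟮θ⟯ ⊔ (CyclotomicZp.zpExtension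 2).layer 2)) / 6) * θ'' ^ 2 * s'') ∧ 0 < σ ((3365 : ↥(ℚ⟮θ⟯ ⊔ (CyclotomicZp.zpExtension 2).layer 2)) + ((4479 : ↥(ℚ⟮θ⟯ ⊔ (CyclotomicZp.zpExtension 2).layer 2)) / 2) * e'' + (-2238 : ↥(ℚ⟮θ⟯ ⊔ (CyclotomicZp.zpExtension 2).layer 2)) * s'' + ((-3099 : ↥(ℚ⟮θ⟯ ⊔ (CyclotomicZp.zpExtension 2).layer 2)) / 2) * s'' * e'' + ((1682 : ↥(ℚ⟮θ⟯ ⊔ (CyclotomicZp.zpExtension 2).layer 2)) / 3) * θ'' + ((-863 : ↥(ℚ⟮θ⟯ ⊔ (CyclotomicZp.zpExtension 2).layer 2)) / 3) * θ'' * e'' + ((-777 : ↥(ℚ⟮θ⟯ ⊔ (CyclotomicZp.zpExtension 2).layer 2)) / 2) * θ'' * s'' + ((2479 : ↥(ℚ⟮θ⟯ ⊔ (CyclotomicZp.zpExtension 2).layer 2)) / 12) * θ'' * s'' * e'' + ((46 : ↥(ℚ⟮θ⟯ ⊔ (CyclotomicZp.zpExtension 2).layer 2)) / 3) * θ'' ^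 2 + ((-623 : ↥(ℚ⟮θ⟯ ⊔ (CyclotomicZp.zpExtension 2).layer 2)) / 6) * θ'' ^ 2 * e'' + ((-25 : ↥(ℚ⟮θ⟯ ⊔ (CyclotomicZp.zpExtension 2).layer 2)) / 2) * θ'' ^ 2 * s'' + ((875 : ↥(ℚ⟮θ⟯ ⊔ (CyclotomicZp.zpExtension 2).layer 2)) / 12) * θ'' ^ 2 * s'' * e'') ∧ 0 < σ ((-13240 : ↥(ℚ⟮θ⟯ ⊔ (CyclotomicZp.zpExtension 2).layer 2)) + (-15535 : ↥(ℚ⟮θ⟯ ⊔ (CyclotomicZp.zpExtension 2).layer 2)) * e'' + (1757 : ↥(ℚ⟮θ⟯ ⊔ (CyclotomicZp.zpExtension 2).layer 2)) * s'' + (5634 : ↥(ℚ⟮θ⟯ ⊔ (CyclotomicZp.zpExtension 2).layer 2)) * s'' * e'' + ((-5624 : ↥(ℚ⟮θ⟯ ⊔ (CyclotomicZp.zpExtension 2).layer 2)) / 3) * θ'' + (-2420 : ↥(ℚ⟮θ⟯ ⊔ (CyclotomicZp.zpExtension 2).layer 2)) * θ'' * e'' + ((713 : ↥(ℚ⟮θ⟯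 ⊔ (CyclotomicZp.zpExtension 2).layer 2)) / 6) * θ'' * s'' + ((1949 : ↥(ℚ⟮θ⟯ ⊔ (CyclotomicZp.zpExtension 2).layer 2)) / 2) * θ'' * s'' * e'' + ((875 : ↥(ℚ⟮θ⟯ ⊔ (CyclotomicZp.zpExtension 2).layer 2)) / 3) * θ'' ^ 2 + (257 : ↥(ℚ⟮θ⟯ ⊔ (CyclotomicZp.zpExtension 2).layer 2)) * θ'' ^ 2 * e'' + ((-311 : ↥(ℚ⟮θ⟯ ⊔ (CyclotomicZp.zpExtension 2).layer 2)) / 6) * θ'' ^ 2 * s'' + ((-165 : ↥(ℚ⟮θ⟯ ⊔ (CyclotomicZp.zpExtension 2).layer 2)) / 2) * θ'' ^ 2 * s'' * e'') := by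
    intro σ
    have hφ : σ.comp (inclusion hK2).toRingHom ∈ ({ρ₀, ρ₁, ρ₂} : Finset (↥ℚ⟮θ⟯ →+* ℝ)) := huniv ▸ Finset.mem_univ _
    simp only [Finset.mem_insert, Finset.mem_singleton] at hφ
    have hgen : ∀ {ρ : ↥ℚ⟮θ⟯ →+* ℝ} {x : ℝ}, σ.comp (inclusion hK2).toRingHom = ρ → ρ (AdjoinSimple.gen ℚ θ) = x → σ θ'' = x := by
      intro ρ x hρ hx; rw [← hx, ← hρ]; rfl
    have hy2 : (σ s'') ^ 2 = 2 := by rw [← map_pow, hsrel, map_ofNat]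
    have hy : σ s'' = Real.sqrt 2 ∨ σ s'' = -Real.sqrt 2 :=
      sq_eq_sq_iff_eq_or_eq_neg.mp (hy2.trans (Real.sq_sqrt (by norm_num : (0:ℝ) ≤ 2)).symm)
    have hz2 : (σ e'') ^ 2 = 2 + σ s'' := by rw [← map_pow, herel, map_add, map_ofNat]
    have hs2lt : Real.sqrt 2 < 2 := (Real.sqrt_lt' (by norm_num)).mpr (by norm_num)
    have hzp : σ s'' = Real.sqrt 2 → σ e'' = Real.sqrt (2 + Real.sqrt 2) ∨ σ e'' = -Real.sqrt (2 + Real.sqrt 2) := by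
      intro h; rw [h] at hz2
      exact sq_eq_sq_iff_eq_or_eq_neg.mp (hz2.trans (Real.sq_sqrt (by positivity)).symm)
    have hzm : σ s'' = -Real.sqrt 2 → σ e'' = Real.sqrt (2 - Real.sqrt 2) ∨ σ e'' = -Real.sqrt (2 - Real.sqrt 2) := by
      intro h; rw [h, ← sub_eq_add_neg] at hz2
      exact sq_eq_sq_iff_eq_or_eq_neg.mp (hz2.trans (Real.sq_sqrt (by linarith)).symm)
    rcases hφ with hφ | hφ | hφ
    · have hx := hgen hφ hρ₀
      rcases hy with hs | hs
      · rcases hzp hs with hee | hee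
        · exact layer_two_totpos_signs_r0_pp_d51992p σ θ'' s'' e'' x0 hx hs hee hl0 hu0
        · exact layer_two_totpos_signs_r0_pm_d51992p σ θ'' s'' e'' x0 hx hs hee hl0 hu0
      · rcases hzm hs with hee | hee
        · exact layer_two_totpos_signs_r0_mp_d51992p σ θ'' s'' e'' x0 hx hs hee hl0 hu0
        · exact layer_two_totpos_signs_r0_mm_d51992p σ θ'' s'' e'' x0 hx hs hee hl0 hu0
    · have hx := hgen hφ hρ₁
      rcases hy with hs | hs
      · rcases hzp hs with hee | hee
        · exact layer_two_totpos_signs_r1_pp_d51992p σ θ'' s'' e'' x1 hx hs hee hl1 hu1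
        · exact layer_two_totpos_signs_r1_pm_d51992p σ θ'' s'' e'' x1 hx hs hee hl1 hu1
      · rcases hzm hs with hee | hee
        · exact layer_two_totpos_signs_r1_mp_d51992p σ θ'' s'' e'' x1 hx hs hee hl1 hu1
        · exact layer_two_totpos_signs_r1_mm_d51992p σ θ'' s'' e'' x1 hx hs hee hl1 hu1
    · have hx := hgen hφ hρ₂
      rcases hy with hs | hs
      · rcases hzp hs with hee | hee
        · exact layer_two_totpos_signs_r2_pp_d51992p σ θ'' s'' e'' x2 hx hs hee hl2 hu2
        · exact layer_two_totpos_signs_r2_pm_d51992p σ θ'' s'' e'' x2 hx hs hee hl2 hu2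
      · rcases hzm hs with hee | hee
        · exact layer_two_totpos_signs_r2_mp_d51992p σ θ'' s'' e'' x2 hx hs hee hl2 hu2
        · exact layer_two_totpos_signs_r2_mm_d51992p σ θ'' s'' e'' x2 hx hs hee hl2 hu2
  have hpos1 : ∀ σ : ↥(ℚ⟮θ⟯ ⊔ (CyclotomicZp.zpExtension 2).layer 2) →+* ℝ, 0 < σ ((u1 : 𝓞 ↥(ℚ⟮θ⟯ ⊔ (CyclotomicZp.zpExtension 2).layer 2)) : ↥(ℚ⟮θ⟯ ⊔ (CyclotomicZp.zpExtension 2).layer 2)) := fun σ => by rw [hval1]; exact (hsigns σ).1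
  have hpos2 : ∀ σ : ↥(ℚ⟮θ⟯ ⊔ (CyclotomicZp.zpExtension 2).layer 2) →+* ℝ, 0 < σ ((u2 : 𝓞 ↥(ℚ⟮θ⟯ ⊔ (CyclotomicZp.zpExtension 2).layer 2)) : ↥(ℚ⟮θ⟯ ⊔ (CyclotomicZp.zpExtension 2).layer 2)) := fun σ => by rw [hval2]; exact (hsigns σ).2.1
  have hpos3 : ∀ σ : ↥(ℚ⟮θ⟯ ⊔ (CyclotomicZp.zpExtension 2).layer 2) →+* ℝ, 0 < σ ((u3 : 𝓞 ↥(ℚ⟮θ⟯ ⊔ (CyclotomicZp.zpExtension 2).layer 2)) : ↥(ℚ⟮θ⟯ ⊔ (CyclotomicZp.zpExtension 2).layer 2)) := fun σ => by rw [hval3]; exact (hsigns σ).2.2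
  -- `12·uᵢ ∈ ℤ[θ, s, e]`: the relations pinning the residues of the units
  have h12u1 : (12 : 𝓞 ↥(ℚ⟮θ⟯ ⊔ (CyclotomicZp.zpExtension 2).layer 2)) * (u1 : 𝓞 ↥(ℚ⟮θ⟯ ⊔ (CyclotomicZp.zpExtension 2).layer 2)) = ((192 : 𝓞 ↥(ℚ⟮θ⟯ ⊔ (CyclotomicZp.zpExtension 2).layer 2)) + (138 : 𝓞 ↥(ℚ⟮θ⟯ ⊔ (CyclotomicZp.zpExtension 2).layer 2)) * sE + (14 : 𝓞 ↥(ℚ⟮θ⟯ ⊔ (CyclotomicZp.zpExtension 2).layer 2)) * bE + (8 : 𝓞 ↥(ℚ⟮θ⟯ ⊔ (CyclotomicZp.zpExtension 2).layer 2)) * bE * sE + (-2 : 𝓞 ↥(ℚ⟮θ⟯ ⊔ (CyclotomicZp.zpExtension 2).layer 2)) * bE ^ 2 + (-2 : 𝓞 ↥(ℚ⟮θ⟯ ⊔ (CyclotomicZp.zpExtension 2).layer 2)) * bE ^ 2 * sE) := by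
    apply NumberField.RingOfIntegers.coe_injective
    simp only [map_add, map_sub, map_mul, map_pow, map_neg, map_one, map_zero, map_ofNat, hbE', hsE', heE']
    rw [← NumberField.RingOfIntegers.coe_eq_algebraMap, hval1]
    ring
  have h12u2 : (12 : 𝓞 ↥(ℚ⟮θ⟯ ⊔ (CyclotomicZp.zpExtension 2).layer 2)) * (u2 : 𝓞 ↥(ℚ⟮θ⟯ ⊔ (CyclotomicZp.zpExtension 2).layer 2)) = ((40380 : 𝓞 ↥(ℚ⟮θ⟯ ⊔ (CyclotomicZp.zpExtension 2).layer 2)) + (26874 : 𝓞 ↥(ℚ⟮θ⟯ ⊔ (CyclotomicZp.zpExtension 2).layer 2)) * eE + (-26856 : 𝓞 ↥(ℚ⟮θ⟯ ⊔ (CyclotomicZp.zpExtension 2).layer 2)) * sE + (-18594 : 𝓞 ↥(ℚ⟮θ⟯ ⊔ (CyclotomicZp.zpExtension 2).layer 2)) * sE * eE + (6728 : 𝓞 ↥(ℚ⟮θ⟯ ⊔ (CyclotomicZp.zpExtension 2).layer 2)) * bE + (-3452 : 𝓞 ↥(ℚ⟮θ⟯ ⊔ (CyclotomicZp.zpExtension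 2).layer 2)) * bE * eE + (-4662 : 𝓞 ↥(ℚ⟮θ⟯ ⊔ (CyclotomicZp.zpExtension 2).layer 2)) * bE * sE + (2479 : 𝓞 ↥(ℚ⟮θ⟯ ⊔ (CyclotomicZp.zpExtension 2).layer 2)) * bE * sE * eE + (184 : 𝓞 ↥(ℚ⟮θ⟯ ⊔ (CyclotomicZp.zpExtension 2).layer 2)) * bE ^ 2 + (-1246 : 𝓞 ↥(ℚ⟮θ⟯ ⊔ (CyclotomicZp.zpExtension 2).layer 2)) * bE ^ 2 * eE + (-150 : 𝓞 ↥(ℚ⟮θ⟯ ⊔ (CyclotomicZp.zpExtension 2).layer 2)) * bE ^ 2 * sE + (875 : 𝓞 ↥(ℚ⟮θ⟯ ⊔ (CyclotomicZp.zpExtension 2).layer 2)) * bE ^ 2 * sE * eE) := by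
    apply NumberField.RingOfIntegers.coe_injective
    simp only [map_add, map_sub, map_mul, map_pow, map_neg, map_one, map_zero, map_ofNat, hbE', hsE', heE']
    rw [← NumberField.RingOfIntegers.coe_eq_algebraMap, hval2]
    ring
  have h12u3 : (12 : 𝓞 ↥(ℚ⟮θ⟯ ⊔ (CyclotomicZp.zpExtension 2).layer 2)) * (u3 : 𝓞 ↥(ℚ⟮θ⟯ ⊔ (CyclotomicZp.zpExtension 2).layer 2)) = ((-158880 : 𝓞 ↥(ℚ⟮θ⟯ ⊔ (CyclotomicZp.zpExtension 2).layer 2)) + (-186420 : 𝓞 ↥(ℚ⟮θ⟯ ⊔ (CyclotomicZp.zpExtension 2).layer 2)) * eE + (21084 : 𝓞 ↥(ℚ⟮θ⟯ ⊔ (CyclotomicZp.zpExtension 2).layer 2)) * sE + (67608 : 𝓞 ↥(ℚ⟮θ⟯ ⊔ (CyclotomicZp.zpExtension 2).layer 2)) * sE * eE + (-22496 : 𝓞 ↥(ℚ⟮θ⟯ ⊔ (CyclotomicZp.zpExtension 2).layer 2)) * bE + (-29040 : 𝓞 ↥(ℚ⟮θ⟯ ⊔ (CyclotomicZp.zpExtension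 2).layer 2)) * bE * eE + (1426 : 𝓞 ↥(ℚ⟮θ⟯ ⊔ (CyclotomicZp.zpExtension 2).layer 2)) * bE * sE + (11694 : 𝓞 ↥(ℚ⟮θ⟯ ⊔ (CyclotomicZp.zpExtension 2).layer 2)) * bE * sE * eE + (3500 : 𝓞 ↥(ℚ⟮θ⟯ ⊔ (CyclotomicZp.zpExtension 2).layer 2)) * bE ^ 2 + (3084 : 𝓞 ↥(ℚ⟮θ⟯ ⊔ (CyclotomicZp.zpExtension 2).layer 2)) * bE ^ 2 * eE + (-622 : 𝓞 ↥(ℚ⟮θ⟯ ⊔ (CyclotomicZp.zpExtension 2).layer 2)) * bE ^ 2 * sE + (-990 : 𝓞 ↥(ℚ⟮θ⟯ ⊔ (CyclotomicZp.zpExtension 2).layer 2)) * bE ^ 2 * sE * eE) := by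
    apply NumberField.RingOfIntegers.coe_injective
    simp only [map_add, map_sub, map_mul, map_pow, map_neg, map_one, map_zero, map_ofNat, hbE', hsE', heE']
    rw [← NumberField.RingOfIntegers.coe_eq_algebraMap, hval3]
    ring
  -- residue witnesses: none of the products is a unit square
  have hdisc : ((16 * Cubic.discr ⟨1, (-1 : ℤ), (-102 : ℤ), (-342 : ℤ)⟩ : ℤ) : ZMod 17) ≠ 0 := by
    simp only [Cubic.discr]; decide
  obtain ⟨φ1, hφ1b, hφ1e⟩ := exists_ringHom_zmod_aux_d51992p irreducible_cubic_d51992p hθ (isTotallyReal_adjoin_d51992p_lb hθ) he he0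
    (by norm_num : Nat.Prime 17) hdisc (x := (9 : ZMod 17)) (y := (5 : ZMod 17)) (by decide) (by decide)
  have hφ1u : φ1 (u1 : 𝓞 ↥(ℚ⟮θ⟯ ⊔ (CyclotomicZp.zpExtension 2).layer 2)) = 3 ∧ φ1 (u2 : 𝓞 ↥(ℚ⟮θ⟯ ⊔ (CyclotomicZp.zpExtension 2).layer 2)) = 8 ∧ φ1 (u3 : 𝓞 ↥(ℚ⟮θ⟯ ⊔ (CyclotomicZp.zpExtension 2).layer 2)) = 15 := by
    have hb' : φ1 bE = 9 := hφ1b bE hbEval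
    have he' : φ1 eE = 5 := hφ1e eE heEval
    have hs' : φ1 sE = 5 ^ 2 - 2 := by rw [hsEdef, map_sub, map_pow, he', map_ofNat]
    have k1 := congrArg φ1 h12u1; have k2 := congrArg φ1 h12u2; have k3 := congrArg φ1 h12u3
    simp only [map_add, map_sub, map_mul, map_pow, map_neg, map_one, map_zero, map_ofNat, hb', he', hs'] at k1 k2 k3
    have h12 : (10 * 12 : ZMod 17) = 1 := by decide
    refine ⟨?_, ?_, ?_⟩
    · have h1 : φ1 (u1 : 𝓞 ↥(ℚ⟮θ⟯ ⊔ (CyclotomicZp.zpExtension 2).layer 2)) = (10 * 12 : ZMod 17) * φ1 (u1 : 𝓞 ↥(ℚ⟮θ⟯ ⊔ (CyclotomicZp.zpExtension 2).layer 2)) := by rw [h12, one_mul]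
      rw [h1, mul_assoc, k1]; decide
    · have h1 : φ1 (u2 : 𝓞 ↥(ℚ⟮θ⟯ ⊔ (CyclotomicZp.zpExtension 2).layer 2)) = (10 * 12 : ZMod 17) * φ1 (u2 : 𝓞 ↥(ℚ⟮θ⟯ ⊔ (CyclotomicZp.zpExtension 2).layer 2)) := by rw [h12, one_mul]
      rw [h1, mul_assoc, k2]; decide
    · have h1 : φ1 (u3 : 𝓞 ↥(ℚ⟮θ⟯ ⊔ (CyclotomicZp.zpExtension 2).layer 2)) = (10 * 12 : ZMod 17) * φ1 (u3 : 𝓞 ↥(ℚ⟮θ⟯ ⊔ (CyclotomicZp.zpExtension 2).layer 2)) := by rw [h12, one_mul]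
      rw [h1, mul_assoc, k3]; decide
  have h1 : ∀ w : (𝓞 ↥(ℚ⟮θ⟯ ⊔ (CyclotomicZp.zpExtension 2).layer 2))ˣ, u1 ≠ w ^ 2 := by
    have hv : φ1 ((u1 : (𝓞 ↥(ℚ⟮θ⟯ ⊔ (CyclotomicZp.zpExtension 2).layer 2))ˣ) : 𝓞 ↥(ℚ⟮θ⟯ ⊔ (CyclotomicZp.zpExtension 2).layer 2)) = (3 : ZMod 17) := hφ1u.1
    intro w hw
    exact not_exists_eq_sq_of_map_not_isSquare φ1 (u1) (by rw [hv]; decide) ⟨w, hw⟩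
  have h13 : ∀ w : (𝓞 ↥(ℚ⟮θ⟯ ⊔ (CyclotomicZp.zpExtension 2).layer 2))ˣ, u1 * u3 ≠ w ^ 2 := by
    have hv : φ1 ((u1 * u3 : (𝓞 ↥(ℚ⟮θ⟯ ⊔ (CyclotomicZp.zpExtension 2).layer 2))ˣ) : 𝓞 ↥(ℚ⟮θ⟯ ⊔ (CyclotomicZp.zpExtension 2).layer 2)) = (11 : ZMod 17) := by
      simp only [Units.val_mul, map_mul, hφ1u.1, hφ1u.2.1, hφ1u.2.2]; decide
    intro w hw
    exact not_exists_eq_sq_of_map_not_isSquare φ1 (u1 * u3) (by rw [hv]; decide) ⟨w, hw⟩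
  have h12 : ∀ w : (𝓞 ↥(ℚ⟮θ⟯ ⊔ (CyclotomicZp.zpExtension 2).layer 2))ˣ, u1 * u2 ≠ w ^ 2 := by
    have hv : φ1 ((u1 * u2 : (𝓞 ↥(ℚ⟮θ⟯ ⊔ (CyclotomicZp.zpExtension 2).layer 2))ˣ) : 𝓞 ↥(ℚ⟮θ⟯ ⊔ (CyclotomicZp.zpExtension 2).layer 2)) = (7 : ZMod 17) := by
      simp only [Units.val_mul, map_mul, hφ1u.1, hφ1u.2.1, hφ1u.2.2]; decide
    intro w hw
    exact not_exists_eq_sq_of_map_not_isSquare φ1 (u1 * u2) (by rw [hv]; decide) ⟨w, hw⟩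
  have h123 : ∀ w : (𝓞 ↥(ℚ⟮θ⟯ ⊔ (CyclotomicZp.zpExtension 2).layer 2))ˣ, u1 * u2 * u3 ≠ w ^ 2 := by
    have hv : φ1 ((u1 * u2 * u3 : (𝓞 ↥(ℚ⟮θ⟯ ⊔ (CyclotomicZp.zpExtension 2).layer 2))ˣ) : 𝓞 ↥(ℚ⟮θ⟯ ⊔ (CyclotomicZp.zpExtension 2).layer 2)) = (3 : ZMod 17) := by
      simp only [Units.val_mul, map_mul, hφ1u.1, hφ1u.2.1, hφ1u.2.2]; decide
    intro w hw
    exact not_exists_eq_sq_of_map_not_isSquare φ1 (u1 * u2 * u3) (by rw [hv]; decide) ⟨w, hw⟩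
  obtain ⟨φ2, hφ2b, hφ2e⟩ := exists_ringHom_zmod_aux_d51992p irreducible_cubic_d51992p hθ (isTotallyReal_adjoin_d51992p_lb hθ) he he0
    (by norm_num : Nat.Prime 17) hdisc (x := (9 : ZMod 17)) (y := (8 : ZMod 17)) (by decide) (by decide)
  have hφ2u : φ2 (u1 : 𝓞 ↥(ℚ⟮θ⟯ ⊔ (CyclotomicZp.zpExtension 2).layer 2)) = 6 ∧ φ2 (u2 : 𝓞 ↥(ℚ⟮θ⟯ ⊔ (CyclotomicZp.zpExtension 2).layer 2)) = 12 ∧ φ2 (u3 : 𝓞 ↥(ℚ⟮θ⟯ ⊔ (CyclotomicZp.zpExtension 2).layer 2)) = 10 := by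
    have hb' : φ2 bE = 9 := hφ2b bE hbEval
    have he' : φ2 eE = 8 := hφ2e eE heEval
    have hs' : φ2 sE = 8 ^ 2 - 2 := by rw [hsEdef, map_sub, map_pow, he', map_ofNat]
    have k1 := congrArg φ2 h12u1; have k2 := congrArg φ2 h12u2; have k3 := congrArg φ2 h12u3
    simp only [map_add, map_sub, map_mul, map_pow, map_neg, map_one, map_zero, map_ofNat, hb', he', hs'] at k1 k2 k3
    have h12 : (10 * 12 : ZMod 17) = 1 := by decide
    refine ⟨?_, ?_, ?_⟩
    · have h1 : φ2 (u1 : 𝓞 ↥(ℚ⟮θ⟯ ⊔ (CyclotomicZp.zpExtension 2).layer 2)) = (10 * 12 : ZMod 17) * φ2 (u1 : 𝓞 ↥(ℚ⟮θ⟯ ⊔ (CyclotomicZp.zpExtension 2).layer 2)) := by rw [h12, one_mul]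
      rw [h1, mul_assoc, k1]; decide
    · have h1 : φ2 (u2 : 𝓞 ↥(ℚ⟮θ⟯ ⊔ (CyclotomicZp.zpExtension 2).layer 2)) = (10 * 12 : ZMod 17) * φ2 (u2 : 𝓞 ↥(ℚ⟮θ⟯ ⊔ (CyclotomicZp.zpExtension 2).layer 2)) := by rw [h12, one_mul]
      rw [h1, mul_assoc, k2]; decide
    · have h1 : φ2 (u3 : 𝓞 ↥(ℚ⟮θ⟯ ⊔ (CyclotomicZp.zpExtension 2).layer 2)) = (10 * 12 : ZMod 17) * φ2 (u3 : 𝓞 ↥(ℚ⟮θ⟯ ⊔ (CyclotomicZp.zpExtension 2).layer 2)) := by rw [h12, one_mul]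
      rw [h1, mul_assoc, k3]; decide
  have h3 : ∀ w : (𝓞 ↥(ℚ⟮θ⟯ ⊔ (CyclotomicZp.zpExtension 2).layer 2))ˣ, u3 ≠ w ^ 2 := by
    have hv : φ2 ((u3 : (𝓞 ↥(ℚ⟮θ⟯ ⊔ (CyclotomicZp.zpExtension 2).layer 2))ˣ) : 𝓞 ↥(ℚ⟮θ⟯ ⊔ (CyclotomicZp.zpExtension 2).layer 2)) = (10 : ZMod 17) := hφ2u.2.2
    intro w hw
    exact not_exists_eq_sq_of_map_not_isSquare φ2 (u3) (by rw [hv]; decide) ⟨w, hw⟩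
  have h2 : ∀ w : (𝓞 ↥(ℚ⟮θ⟯ ⊔ (CyclotomicZp.zpExtension 2).layer 2))ˣ, u2 ≠ w ^ 2 := by
    have hv : φ2 ((u2 : (𝓞 ↥(ℚ⟮θ⟯ ⊔ (CyclotomicZp.zpExtension 2).layer 2))ˣ) : 𝓞 ↥(ℚ⟮θ⟯ ⊔ (CyclotomicZp.zpExtension 2).layer 2)) = (12 : ZMod 17) := hφ2u.2.1
    intro w hw
    exact not_exists_eq_sq_of_map_not_isSquare φ2 (u2) (by rw [hv]; decide) ⟨w, hw⟩
  obtain ⟨φ3, hφ3b, hφ3e⟩ := exists_ringHom_zmod_aux_d51992p irreducible_cubic_d51992p hθ (isTotallyReal_adjoin_d51992p_lb hθ) he he0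
    (by norm_num : Nat.Prime 17) hdisc (x := (9 : ZMod 17)) (y := (9 : ZMod 17)) (by decide) (by decide)
  have hφ3u : φ3 (u1 : 𝓞 ↥(ℚ⟮θ⟯ ⊔ (CyclotomicZp.zpExtension 2).layer 2)) = 6 ∧ φ3 (u2 : 𝓞 ↥(ℚ⟮θ⟯ ⊔ (CyclotomicZp.zpExtension 2).layer 2)) = 9 ∧ φ3 (u3 : 𝓞 ↥(ℚ⟮θ⟯ ⊔ (CyclotomicZp.zpExtension 2).layer 2)) = 12 := by
    have hb' : φ3 bE = 9 := hφ3b bE hbEval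
    have he' : φ3 eE = 9 := hφ3e eE heEval
    have hs' : φ3 sE = 9 ^ 2 - 2 := by rw [hsEdef, map_sub, map_pow, he', map_ofNat]
    have k1 := congrArg φ3 h12u1; have k2 := congrArg φ3 h12u2; have k3 := congrArg φ3 h12u3
    simp only [map_add, map_sub, map_mul, map_pow, map_neg, map_one, map_zero, map_ofNat, hb', he', hs'] at k1 k2 k3
    have h12 : (10 * 12 : ZMod 17) = 1 := by decide
    refine ⟨?_, ?_, ?_⟩
    · have h1 : φ3 (u1 : 𝓞 ↥(ℚ⟮θ⟯ ⊔ (CyclotomicZp.zpExtension 2).layer 2)) = (10 * 12 : ZMod 17) * φ3 (u1 : 𝓞 ↥(ℚ⟮θ⟯ ⊔ (CyclotomicZp.zpExtension 2).layer 2)) := by rw [h12, one_mul]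
      rw [h1, mul_assoc, k1]; decide
    · have h1 : φ3 (u2 : 𝓞 ↥(ℚ⟮θ⟯ ⊔ (CyclotomicZp.zpExtension 2).layer 2)) = (10 * 12 : ZMod 17) * φ3 (u2 : 𝓞 ↥(ℚ⟮θ⟯ ⊔ (CyclotomicZp.zpExtension 2).layer 2)) := by rw [h12, one_mul]
      rw [h1, mul_assoc, k2]; decide
    · have h1 : φ3 (u3 : 𝓞 ↥(ℚ⟮θ⟯ ⊔ (CyclotomicZp.zpExtension 2).layer 2)) = (10 * 12 : ZMod 17) * φ3 (u3 : 𝓞 ↥(ℚ⟮θ⟯ ⊔ (CyclotomicZp.zpExtension 2).layer 2)) := by rw [h12, one_mul]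
      rw [h1, mul_assoc, k3]; decide
  have h23 : ∀ w : (𝓞 ↥(ℚ⟮θ⟯ ⊔ (CyclotomicZp.zpExtension 2).layer 2))ˣ, u2 * u3 ≠ w ^ 2 := by
    have hv : φ3 ((u2 * u3 : (𝓞 ↥(ℚ⟮θ⟯ ⊔ (CyclotomicZp.zpExtension 2).layer 2))ˣ) : 𝓞 ↥(ℚ⟮θ⟯ ⊔ (CyclotomicZp.zpExtension 2).layer 2)) = (6 : ZMod 17) := by
      simp only [Units.val_mul, map_mul, hφ3u.1, hφ3u.2.1, hφ3u.2.2]; decide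
    intro w hw
    exact not_exists_eq_sq_of_map_not_isSquare φ3 (u2 * u3) (by rw [hv]; decide) ⟨w, hw⟩
  exact eight_le_card_totPosUnitsModSq_of_ne_sq u1 u2 u3 hpos1 hpos2 hpos3 h1 h2 h3
    h12 h13 h23 h123

end Summit.BirchSwinnertonDyer.BirchSwinnertonDyer.Theorems.AddKatoTwo

end
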